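import Summits.ValiantsHypothesis.ValiantsHypothesis.Theorems.SymPencilEquivariantSdcNotQPInvariantSubspaceDets
import HarnessLib

/-!
# ValiantsHypothesis / SymPencil — crux `EquivariantSdcNotQP` (stmt-ValiantsHypothesis-17792), line
# `birth_EquivariantSdcNotQP`, open piece (ii′) `FiniteConjugationLift` of `stub_permify`:
# PART C — compression to a subquotient: multiplicativity, block factorisation, Schur's lemma

Helper of the item (`--supports stmt-ValiantsHypothesis-17792 --as helper`; no definitions, no named
facts).  Linear algebra over a field `K` (`V` finite-dimensional) for a pair of subspaces `U ≤ S`: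
* `compression_comp`, `compression_id` — if `ι : C → V` lands in `S`, `π : V → C` kills `U` and
  `w - ι(π w) ∈ U` on `S`, then `π (X Y) ι = (π X ι)(π Y ι)` for `X` preserving `U` and `Y`
  preserving `S`: compression to "`S/U` read on `C`" is multiplicative;
* `exists_compression_data` — such `(C, π)` exist with `C ≤ S`, `dim C + dim U = dim S` and the
  block factorisation `det X|_S = det X|_U · det (π X ι_C)` for every `X` preserving `S` and `U`
  (Part A's `det_eq_det_restrict_mul_det_compression` inside `S`, transported to `V`);
* `compression_schur` — if no invariant subspace of a family `T i` lies strictly between `U` and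
  `S`, every endomorphism of `C` commuting with all compressions `π (T i) ι_C` is a scalar
  (`K` algebraically closed: an eigenspace lifts to an invariant `U ⊔ ι(E)` between `U` and `S`);
* matrix bookkeeping for polynomial matrices: `map_C_map_eval`, `map_C_map_rename`,
  `matrix_eq_of_forall_map_eval_eq` (a polynomial matrix is determined by its evaluations,
  `MvPolynomial.funext`), `smul_map_eval`, `map_rename_sandwich`, `map_rename_rename`.

Honest framing: infrastructure; (ii′) is assembled in `…FiniteConjugationLift.lean`; `stub_permify`,
the crux and `VP ≠ VNP` remain OPEN and nothing here is progress on them.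
-/

noncomputable section

set_option linter.dupNamespace false

namespace Summit.ValiantsHypothesis.ValiantsHypothesis.Theorems.SymPencilEquivariantSdcNotQP

open Module Submodule

/-! ## Part C — compression to `W⋆/U`, induced lifts, Schur -/

section Compression

variable {K : Type*} [Field K] {V : Type*} [AddCommGroup V] [Module K V] [FiniteDimensional K V]

omit [FiniteDimensional K V] in
/-- **Compression is multiplicative** on endomorphisms preserving the pair `U ≤ S`: if `ι : C → V`
lands in `S`, `π : V → C` kills `U`, and `w - ι (π w) ∈ U` for `w ∈ S` (so `C` is a complement of
`U` in `S` read through `π, ι`), then `π X Y ι = (π X ι)(π Y ι)` whenever `Y(S) ⊆ S` and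
`X(U) ⊆ U`. [folklore] -/
theorem compression_comp {C : Type*} [AddCommGroup C] [Module K C] {S U : Submodule K V}
    (π : V →ₗ[K] C) (ι : C →ₗ[K] V) (hι : ∀ c, ι c ∈ S) (hπU : ∀ u ∈ U, π u = 0)
    (hπS : ∀ w ∈ S, w - ι (π w) ∈ U) (X Y : V →ₗ[K] V)
    (hXU : U ≤ U.comap X) (hYS : S ≤ S.comap Y) :
    π ∘ₗ (X ∘ₗ Y) ∘ₗ ι = (π ∘ₗ X ∘ₗ ι) ∘ₗ (π ∘ₗ Y ∘ₗ ι) := by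
  ext c
  have hYc : Y (ι c) ∈ S := hYS (hι c)
  have hU : Y (ι c) - ι (π (Y (ι c))) ∈ U := hπS _ hYc
  have hXU' : X (Y (ι c) - ι (π (Y (ι c)))) ∈ U := hXU hU
  have h0 := hπU _ hXU'
  rw [map_sub, map_sub, sub_eq_zero] at h0
  simpa using h0

omit [FiniteDimensional K V] in
/-- A retraction datum as above makes `π ∘ ι = id`. [folklore] -/
theorem compression_id {C : Type*} [AddCommGroup C] [Module K C]
    (π : V →ₗ[K] C) (ι : C →ₗ[K] V) (hπι : ∀ c, π (ι c) = c) :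
    π ∘ₗ ι = LinearMap.id :=
  LinearMap.ext hπι

/-- **Compression data for a pair `U < S`.**  There are a subspace `C ≤ S` and a linear
`π : V → C` with `π|_C = id`, `π(U) = 0`, `w - π w ∈ U` for `w ∈ S`, `dim C + dim U = dim S`, and the
block factorisation `det X|_S = det X|_U · det (π X ι_C)` for every `X` preserving `S` and `U`.
[folklore] -/
theorem exists_compression_data {S U : Submodule K V} (hUS : U ≤ S) :
    ∃ (C : Submodule K V) (π : V →ₗ[K] C), C ≤ S ∧ (∀ c : C, π c = c) ∧ (∀ u ∈ U, π u = 0) ∧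
      (∀ w ∈ S, w - (π w : V) ∈ U) ∧
      Module.finrank K C + Module.finrank K U = Module.finrank K S ∧
      ∀ (X : V →ₗ[K] V) (hXS : S ≤ S.comap X) (hXU : U ≤ U.comap X),
        LinearMap.det (X.restrict hXS) =
          LinearMap.det (X.restrict hXU) * LinearMap.det (π ∘ₗ X ∘ₗ C.subtype) := by
  classical
  -- inside `S`: `U' := U ∩ S` (= `U`) and a complement `C₀`
  set U' : Submodule K S := U.comap S.subtype with hU'
  obtain ⟨C₀, hC₀⟩ := U'.exists_isCompl
  -- a retraction `r : V → S`
  obtain ⟨r, hr⟩ := S.subtype.exists_leftInverse_of_injective S.ker_subtype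
  have hr' : ∀ w : S, r w = w := fun w => LinearMap.congr_fun hr w
  set p₀ : S →ₗ[K] C₀ := C₀.projectionOnto U' hC₀.symm with hp₀
  set e : C₀ ≃ₗ[K] ↥(C₀.map S.subtype) :=
    Submodule.equivMapOfInjective S.subtype S.injective_subtype C₀ with he
  refine ⟨C₀.map S.subtype, e.toLinearMap ∘ₗ p₀ ∘ₗ r, Submodule.map_subtype_le _ _, ?_, ?_, ?_, ?_, ?_⟩
  · -- `π c = c`
    intro c
    obtain ⟨c₀, rfl⟩ := e.surjective c
    have hc : ((e c₀ : ↥(C₀.map S.subtype)) : V) = ((c₀ : S) : V) := by simp [he]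
    simp only [LinearMap.coe_comp, LinearEquiv.coe_coe, Function.comp_apply, hc, hr',
      hp₀, Submodule.projectionOnto_apply_left]
  · -- `π u = 0`
    intro u hu
    have huS : u ∈ S := hUS hu
    have hu' : (⟨u, huS⟩ : S) ∈ U' := by simpa [hU'] using hu
    have : r u = ⟨u, huS⟩ := hr' ⟨u, huS⟩
    simp only [LinearMap.coe_comp, LinearEquiv.coe_coe, Function.comp_apply, this, hp₀,
      Submodule.projectionOnto_apply_of_mem_right _ hu', map_zero]
  · -- `w - π w ∈ U`
    intro w hw
    have hrw : r w = ⟨w, hw⟩ := hr' ⟨w, hw⟩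
    have hmem := Submodule.sub_projection_mem hC₀.symm (⟨w, hw⟩ : S)
    -- read the membership in `U' = U.comap S.subtype` back in `V`
    have hmem' : S.subtype ((⟨w, hw⟩ : S) - C₀.projection U' hC₀.symm ⟨w, hw⟩) ∈ U := hmem
    rw [map_sub] at hmem'
    have hc : ((e (p₀ (r w)) : ↥(C₀.map S.subtype)) : V) = ((p₀ (r w) : S) : V) := by simp [he]
    show w - ((e (p₀ (r w)) : ↥(C₀.map S.subtype)) : V) ∈ U
    rw [hc, hrw]
    simpa [hp₀] using hmem'
  · -- dimensions
    have h1 : Module.finrank K ↥(C₀.map S.subtype) = Module.finrank K C₀ := e.finrank_eq.symm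
    have h2 : Module.finrank K U' = Module.finrank K U :=
      (Submodule.comapSubtypeEquivOfLe hUS).finrank_eq
    have h3 := Submodule.finrank_sup_add_finrank_inf_eq U' C₀
    rw [hC₀.sup_eq_top, hC₀.inf_eq_bot, finrank_top, finrank_bot, add_zero] at h3
    omega
  · -- block factorisation
    intro X hXS hXU
    set Xs : S →ₗ[K] S := X.restrict hXS with hXs
    have hU'inv : U' ≤ U'.comap Xs := by
      intro x hx
      simp only [hU', Submodule.mem_comap, Submodule.coe_subtype, hXs, LinearMap.coe_restrict_apply] at hx ⊢
      exact hXU hx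
    have hfac := det_eq_det_restrict_mul_det_compression Xs hU'inv hC₀
    rw [det_restrict_restrict X hXS hXU hUS] at hfac
    rw [hfac]
    congr 1
    -- the compression inside `S` is conjugate (by `e`) to the compression read in `V`
    have key : e.toLinearMap ∘ₗ ((C₀.projectionOnto U' hC₀.symm) ∘ₗ Xs ∘ₗ C₀.subtype) ∘ₗ
        e.symm.toLinearMap = (e.toLinearMap ∘ₗ p₀ ∘ₗ r) ∘ₗ X ∘ₗ (C₀.map S.subtype).subtype := by
      ext y
      obtain ⟨c₀, rfl⟩ := e.surjective y
      have hc : ((e c₀ : ↥(C₀.map S.subtype)) : V) = ((c₀ : S) : V) := by simp [he]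
      have hXc : X ((c₀ : S) : V) ∈ S := hXS (c₀ : S).2
      have hrX : r (X ((c₀ : S) : V)) = ⟨X ((c₀ : S) : V), hXc⟩ := hr' ⟨_, hXc⟩
      have hXs' : Xs (c₀ : S) = ⟨X ((c₀ : S) : V), hXc⟩ := by
        apply Subtype.ext
        simp [hXs, LinearMap.coe_restrict_apply]
      simp only [LinearMap.coe_comp, LinearEquiv.coe_coe, Function.comp_apply, Submodule.coe_subtype,
        LinearEquiv.symm_apply_apply, hc, hrX, hXs', hp₀]
    rw [← key, LinearMap.det_conj]

/-- **Schur's lemma for the compressed pencil.**  With compression data `(C, π)` for `U < S` as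
above, if the invariant subspaces `W` with `U ≤ W ≤ S` of a family `T i` (all preserving `S` and
`U`) are only `U` and `S`, then every endomorphism of `C` commuting with all compressions
`π (T i) ι_C` is a scalar (`K` algebraically closed). [folklore] -/
theorem compression_schur [IsAlgClosed K] {I : Type*} (T : I → (V →ₗ[K] V))
    {S U C : Submodule K V} (hUS : U < S) (hCS : C ≤ S) (π : V →ₗ[K] C)
    (hπC : ∀ c : C, π c = c) (hπU : ∀ u ∈ U, π u = 0) (hπS : ∀ w ∈ S, w - (π w : V) ∈ U)
    (hdim : Module.finrank K C + Module.finrank K U = Module.finrank K S)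
    (hTS : ∀ i, S ≤ S.comap (T i)) (hTU : ∀ i, U ≤ U.comap (T i))
    (hsimple : ∀ W : Submodule K V, (∀ i, W ≤ W.comap (T i)) → U ≤ W → W < S → W ≤ U)
    (H : C →ₗ[K] C) (hH : ∀ i, (π ∘ₗ T i ∘ₗ C.subtype) ∘ₗ H = H ∘ₗ (π ∘ₗ T i ∘ₗ C.subtype)) :
    ∃ μ : K, H = μ • LinearMap.id := by
  classical
  -- `C` is nontrivial
  have hCpos : 0 < Module.finrank K C := by
    have := Submodule.finrank_lt_finrank_of_lt hUS
    omega
  haveI : Nontrivial C := Module.finrank_pos_iff.mp hCpos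
  obtain ⟨μ, hμ⟩ := Module.End.exists_eigenvalue H
  refine ⟨μ, ?_⟩
  set E : Submodule K C := Module.End.eigenspace H μ with hE
  -- the eigenspace is invariant under the compressions
  have hEinv : ∀ i, E ≤ E.comap (π ∘ₗ T i ∘ₗ C.subtype) := by
    intro i x hx
    rw [Submodule.mem_comap, hE, Module.End.mem_eigenspace_iff]
    rw [hE, Module.End.mem_eigenspace_iff] at hx
    have := LinearMap.congr_fun (hH i) x
    simp only [LinearMap.coe_comp, Function.comp_apply] at this ⊢
    rw [← this, hx, map_smul, map_smul, map_smul]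
  -- lift it to `W := U ⊔ ι(E)`, an invariant subspace between `U` and `S`
  set W : Submodule K V := U ⊔ E.map C.subtype with hW
  have hWinv : ∀ i, W ≤ W.comap (T i) := by
    intro i
    rw [hW]
    refine sup_le ((hTU i).trans (Submodule.comap_mono le_sup_left)) ?_
    rintro _ ⟨x, hx, rfl⟩
    rw [Submodule.mem_comap]
    change T i (x : V) ∈ U ⊔ E.map C.subtype
    have hxS : (x : V) ∈ S := hCS x.2
    have hTxS : T i (x : V) ∈ S := hTS i hxS
    -- `T x = (T x - π T x) + π T x`, first in `U`, second in `ι(E)`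
    have hsplit : T i (x : V) = (T i (x : V) - (π (T i (x : V)) : V)) + (π (T i (x : V)) : V) := by abel
    rw [hsplit]
    refine Submodule.add_mem _ (Submodule.mem_sup_left (hπS _ hTxS)) (Submodule.mem_sup_right ?_)
    refine ⟨π (T i (x : V)), ?_, rfl⟩
    exact hEinv i hx
  have hUW : U ≤ W := le_sup_left
  have hWS : W ≤ S := sup_le hUS.le (by
    rintro _ ⟨x, _, rfl⟩
    exact hCS x.2)
  -- `ι(E) ∩ U = 0`, so `W ≠ U` unless `E = ⊥`
  have hEU : ∀ x : C, (x : V) ∈ U → x = 0 := by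
    intro x hx
    have h1 := hπU _ hx
    rw [hπC] at h1
    exact h1
  -- if `W < S` then `W ≤ U`, forcing `E = ⊥`: contradiction; hence `W = S` and `E = ⊤`
  have hEtop : E = ⊤ := by
    by_contra hne
    rcases eq_or_lt_of_le hWS with heq | hlt
    · -- `W = S`: dimension count forces `E = ⊤`
      apply hne
      have hdimW : Module.finrank K W ≤ Module.finrank K U + Module.finrank K E := by
        have h1 := Submodule.finrank_add_le_finrank_add_finrank U (E.map C.subtype)
        have h2 : Module.finrank K ↥(E.map C.subtype) = Module.finrank K E :=
          (Submodule.equivMapOfInjective C.subtype C.injective_subtype E).finrank_eq.symm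
        rw [hW]; omega
      rw [heq] at hdimW
      have hEle : Module.finrank K C ≤ Module.finrank K E := by omega
      exact Submodule.eq_top_of_finrank_eq (le_antisymm (Submodule.finrank_le E) hEle)
    · have hWU := hsimple W hWinv hUW hlt
      apply hμ
      rw [Submodule.eq_bot_iff]
      intro x hx
      have hxW : (x : V) ∈ W := Submodule.mem_sup_right ⟨x, hx, rfl⟩
      exact hEU x (hWU hxW)
  -- `H = μ` on `E = ⊤`
  refine LinearMap.ext fun x => ?_
  have hx : x ∈ E := hEtop ▸ Submodule.mem_top
  rw [hE, Module.End.mem_eigenspace_iff] at hx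
  rw [hx, LinearMap.smul_apply, LinearMap.id_apply]

end Compression


/-! ## Part D — matrix bookkeeping and the assembly of (ii′) -/

section MatrixLemmas

open MvPolynomial Matrix

variable {σ : Type*}

/-- Constant matrices evaluate to themselves. [folklore] -/
theorem map_C_map_eval {ι₁ ι₂ : Type*} (M : Matrix ι₁ ι₂ ℂ) (a : σ → ℂ) :
    (M.map (MvPolynomial.C : ℂ →+* MvPolynomial σ ℂ)).map (MvPolynomial.eval a) = M := by
  ext i j; simp

/-- Constant matrices are fixed by renamings. [folklore] -/
theorem map_C_map_rename {τ : Type*} {ι₁ ι₂ : Type*} (M : Matrix ι₁ ι₂ ℂ) (f : σ → τ) :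
    (M.map (MvPolynomial.C : ℂ →+* MvPolynomial σ ℂ)).map (MvPolynomial.rename f) =
      M.map (MvPolynomial.C : ℂ →+* MvPolynomial τ ℂ) := by
  ext i j; simp

/-- A polynomial matrix is determined by its evaluations. [folklore] -/
theorem matrix_eq_of_forall_map_eval_eq {ι₁ ι₂ : Type*} {M N : Matrix ι₁ ι₂ (MvPolynomial σ ℂ)}
    (h : ∀ a : σ → ℂ, M.map (MvPolynomial.eval a) = N.map (MvPolynomial.eval a)) : M = N := by
  refine Matrix.ext fun i j => ?_
  exact MvPolynomial.funext fun a => by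
    have := congr_fun (congr_fun (h a) i) j
    simpa [Matrix.map_apply] using this

/-- Evaluating a scalar multiple `C c • M`. [folklore] -/
theorem smul_map_eval {ι₁ ι₂ : Type*} (c : ℂ) (M : Matrix ι₁ ι₂ (MvPolynomial σ ℂ)) (a : σ → ℂ) :
    ((MvPolynomial.C c : MvPolynomial σ ℂ) • M).map (MvPolynomial.eval a) =
      c • M.map (MvPolynomial.eval a) := by
  ext i j; simp [Matrix.map_apply]

/-- Renaming variables commutes with constant sandwiches. [folklore] -/
theorem map_rename_sandwich {τ : Type*} {k l : ℕ} (X : Matrix (Fin l) (Fin k) ℂ)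
    (M : Matrix (Fin k) (Fin k) (MvPolynomial σ ℂ)) (Y : Matrix (Fin k) (Fin l) ℂ) (f : σ → τ) :
    (X.map (MvPolynomial.C : ℂ →+* MvPolynomial σ ℂ) * M *
        Y.map (MvPolynomial.C : ℂ →+* MvPolynomial σ ℂ)).map (MvPolynomial.rename f) =
      X.map (MvPolynomial.C : ℂ →+* MvPolynomial τ ℂ) * M.map (MvPolynomial.rename f) *
        Y.map (MvPolynomial.C : ℂ →+* MvPolynomial τ ℂ) := by
  rw [Matrix.map_mul, Matrix.map_mul, map_C_map_rename, map_C_map_rename]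

/-- Renaming twice. [folklore] -/
theorem map_rename_rename {τ υ : Type*} {ι₁ ι₂ : Type*} (M : Matrix ι₁ ι₂ (MvPolynomial σ ℂ))
    (f : σ → τ) (g : τ → υ) :
    (M.map (MvPolynomial.rename f)).map (MvPolynomial.rename g) = M.map (MvPolynomial.rename (g ∘ f)) := by
  ext i j; simp [Matrix.map_apply, MvPolynomial.rename_rename]

end MatrixLemmas

end Summit.ValiantsHypothesis.ValiantsHypothesis.Theorems.SymPencilEquivariantSdcNotQP

end
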